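import Literature.Computability.QuantumComplexity.MatrixProductStateCut
import HarnessLib

/-!
# A Schmidt-rank-`D` competitor has fidelity at most `√(D · Tr ρ_A²)` — the purity (Rényi-2) form, SVD-free

Topic `Literature/Computability/QuantumComplexity` (companion of `SchmidtRankApproximation.lean` and
`TruncatedStateFidelity.lean`, whose vocabulary — `braket`, `overlapSq`, `IsOrthonormalFamily`, `productSum`,
`contractLeft` — is used and nothing is re-declared). Offered by cell qa-cr (line L-10
`schmidt-rank-purity-ceiling`, whose Summit-side module `SchmidtRankPurityCeiling` proves the same inequality
over curried amplitude tables `Fin dA → Fin dB → ℂ`; this file is its Literature twin in the tree's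
vocabulary, cell ruling R9″). HONEST FRAMING: a finite-dimensional linear-algebra inequality about ONE cut of
ONE pure state; instance-level bookkeeping for bond-dimension arguments; no claim about any circuit family,
about classical simulation cost, or about BQP vs BPP.

## What the sources say

For a bipartite pure state with reduced density operator `ρ_A` across a cut and ANY unit vector `φ` of
Schmidt rank `≤ D` across that cut, the fidelity obeys `|⟨ψ|φ⟩|² ≤ Σ_{i≤D} λ_i(ρ_A)` (Eckart–Young / Ky Fan;
[cite: VidalJonathanNielsen2000, §IV.B (`F_opt = Σ_{i≤m} β_i`)]), and the top-`D` eigenvalue mass is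
controlled by every Rényi entropy `S_α`, `α > 1`: `log D ≥ S_α(ρ_A) + (α/(α−1)) log Σ_{i≤D} λ_i`
[cite: SchuchEtAl2008, α > 1 displays after eq. (5)]; at `α = 2` (`e^{−S₂} = Tr ρ_A²`) the two give
`|⟨ψ|φ⟩|² ≤ √(D · Tr ρ_A²)`. The same purity form is re-derived for matrix-product approximations of
random-circuit states as `F = Σ_{α≤χ} S_α² ≤ √(χ Σ_{α≤χ} S_α⁴) ≤ √(χ tr ρ_L²)`
[cite: MorvanEtAl2024, Supplementary Information §H.2 eqs. (H12)–(H14)], and used as the flat-spectrum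
ESTIMATE `χ ≥ F/Tr(ρ²)` (no square root) in [cite: DecrossEtAl2024, App. A eq. (A36)].

The tree already PROVES the Schmidt-form Rényi statement:
`SchmidtRankApproximation.exp_renyiEnt_mul_overlapSq_rpow_le_card` (`e^{S_α} · F^{α/(α−1)} ≤ D`), for `ψ`
GIVEN as `Σ_k c_k a_k ⊗ b_k` with orthonormal `a`, `b`. This file proves the `α = 2` inequality WITHOUT a
Schmidt decomposition of `ψ`: `ψ : α × β → ℂ` is an arbitrary amplitude table and the purity is the explicit
double sum `Tr ρ_A² = Σ_{a a'} |Σ_b ψ(a,b) conj ψ(a',b)|²` (`purityLeft`). Since the tree has no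
Schmidt-decomposition existence theorem, this is the form that applies to a state handed over as amplitudes
(e.g. a circuit output state); the competitor class is the same (`productSum x y J`, left factors
orthonormal, `#J ≤ D`, right factors arbitrary — the left-canonical form of an MPS cut).

## Contents (all proved; 0 named facts)

* `reducedLeft ψ a a' = Σ_b ψ(a,b) · conj ψ(a',b)` (the reduced density matrix on the left block) and
  `purityLeft ψ = Σ_{a,a'} ‖reducedLeft ψ a a'‖²` (`= Tr ρ_A²`, since `ρ_A` is Hermitian — private
  helpers `reducedLeft_conj_symm`, `purityLeft_nonneg`).
* `norm_sum_conj_mul_sq_le` — Cauchy–Schwarz over a `Finset` in the form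
  `‖Σ_{i∈s} conj(uᵢ) vᵢ‖² ≤ (Σ_{i∈s} ‖uᵢ‖²)(Σ_{i∈s} ‖vᵢ‖²)` [cite: HornJohnson2013, Thm 5.1.4].
* private helpers `sum_norm_sq_contractLeft_eq` (`Σ_b ‖(⟨x|⊗1)ψ (b)‖² = Σ_{a,a'} conj(x a) ρ_A(a,a') x a'`:
  the block weight of `x` is the quadratic form of `ρ_A`), `braket_productSum_eq_sum`
  (`⟨ψ|Σ_j x_j ⊗ y_j⟩ = Σ_j ⟨(⟨x_j|⊗1)ψ|y_j⟩`, as in `SchmidtRankApproximation`),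
  `sum_norm_sq_of_isOrthonormalFamily`.
* **`overlapSq_productSum_le_sqrt_card_mul_purityLeft`** — for ANY `ψ : α × β → ℂ` and any unit
  `φ = Σ_{j∈J} x_j ⊗ y_j` with orthonormal `x`: `|⟨ψ|φ⟩|² ≤ √(#J · Tr ρ_A(ψ)²)`
  [cite: SchuchEtAl2008, after eq. (5) (α = 2)] [cite: VidalJonathanNielsen2000, §IV.B]
  [cite: MorvanEtAl2024, Supplementary Information §H.2 eq. (H14)]. Proof: `⟨ψ|φ⟩ = Σ_j ⟨ψ_j|y_j⟩` with
  `ψ_j = (⟨x_j|⊗1)ψ`; Cauchy–Schwarz over `(j, b)` gives `F ≤ Σ_{j∈J} ‖ψ_j‖²`; each `‖ψ_j‖² = ⟨x_j|ρ_A|x_j⟩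
  ≤ ‖ρ_A x_j‖` (Cauchy–Schwarz, `‖x_j‖ = 1`); Cauchy–Schwarz with the all-ones vector and Bessel for the
  orthonormal `x_j` against the rows of `ρ_A` (`sum_norm_sq_braket_le`) give `Σ_j ‖ψ_j‖² ≤ √(#J · Σ‖ρ_A‖²)`.
  No normalisation of `ψ` is needed (both sides are homogeneous of degree 4 in `ψ`).
* `sum_overlapSq_productSum_le_sqrt` — the finite-ensemble MEAN form: for states `ψ_i` and unit competitors
  `φ_i` of Schmidt rank `≤ D` (`i ∈ ι`, any nonempty finite index type),
  `(1/|ι|) Σ_i |⟨ψ_i|φ_i⟩|² ≤ √(D · (1/|ι|) Σ_i Tr ρ_A(ψ_i)²)` (the pointwise bound and concavity of `√`,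
  as Cauchy–Schwarz with the all-ones vector) [folklore; the averaging used inside the estimate of
  DecrossEtAl2024 (A36), made an inequality].
* `MPS.overlapSq_cutVec_le_sqrt_card_mul_purityLeft` — the same bound read on the object of
  `MatrixProductStateCut.lean`: a LEFT-CANONICAL open-boundary MPS (`leftGram = 1`, unit norm) with bond
  index type `χ` has fidelity `≤ √(#χ · Tr ρ_A(ψ)²)` with ANY amplitude table `ψ` on the chain, at every cut
  (`MPS.cutVec_eq_productSum` + `MPS.isOrthonormalFamily_leftBlock_iff`)
  [cite: SchuchEtAl2008, after eq. (5) (α = 2)] [cite: Schollwoeck2011AnnPhys, §4.1.3 (i)].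
* `not_overlapSq_le_card_mul_purityLeft` — the LINEAR form `|⟨ψ|φ⟩|² ≤ #J · Tr ρ_A²` (the flat-spectrum
  estimate read as an inequality) is FALSE: `ψ = diag(4/5, 3/5)` on `Fin 2 × Fin 2`, `φ = e₀ ⊗ e₀`, `#J = 1`:
  `F = 16/25 > 337/625 = Tr ρ_A²` [folklore counterexample; cf. DecrossEtAl2024 App. A after (A36): 'the bound
  is only tight for states with a flat Schmidt spectrum'].

Not covered: the right block (swap the factors), mixed states / operator-Schmidt rank, anything about which
states have which purity.
-/

open Finset
open scoped BigOperators ComplexConjugate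

namespace Literature.Computability.QuantumComplexity

/-! ### Cauchy–Schwarz over a `Finset` -/

/-- **Cauchy–Schwarz**, `Finset` form: `‖Σ_{i∈s} conj(uᵢ)·vᵢ‖² ≤ (Σ_{i∈s} ‖uᵢ‖²)·(Σ_{i∈s} ‖vᵢ‖²)`.
[cite: HornJohnson2013, Thm 5.1.4 (Cauchy–Schwarz inequality)] -/
theorem norm_sum_conj_mul_sq_le {ι : Type*} (s : Finset ι) (u v : ι → ℂ) :
    ‖∑ i ∈ s, conj (u i) * v i‖ ^ 2 ≤ (∑ i ∈ s, ‖u i‖ ^ 2) * ∑ i ∈ s, ‖v i‖ ^ 2 := by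
  have h1 : ‖∑ i ∈ s, conj (u i) * v i‖ ≤ ∑ i ∈ s, ‖u i‖ * ‖v i‖ := by
    refine (norm_sum_le _ _).trans (le_of_eq (sum_congr rfl fun i _ => ?_))
    rw [norm_mul, Complex.norm_conj]
  exact (pow_le_pow_left₀ (norm_nonneg _) h1 2).trans (sum_mul_sq_le_sq_mul_sq s _ _)

/-! ### The reduced density matrix of the left block and its purity -/

section Reduced

variable {α β : Type*} [Fintype β]

/-- The reduced density matrix of the LEFT block of a bipartite amplitude table:
`ρ_A(ψ)(a, a') = Σ_b ψ(a,b) · conj ψ(a',b)` (`= (Ψ Ψ†)_{a a'}` for the coefficient matrix `Ψ`).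
[cite: VidalJonathanNielsen2000, §III (reduced density matrix `ρ_A = tr_B |ψ⟩⟨ψ|`)] -/
def reducedLeft (ψ : α × β → ℂ) (a a' : α) : ℂ := ∑ b, ψ (a, b) * conj (ψ (a', b))

/-- `ρ_A` is Hermitian: `ρ_A(a', a) = conj ρ_A(a, a')` (so `purityLeft` below is `Tr ρ_A²`). [folklore] -/
private theorem reducedLeft_conj_symm (ψ : α × β → ℂ) (a a' : α) :
    reducedLeft ψ a' a = conj (reducedLeft ψ a a') := by
  unfold reducedLeft
  rw [map_sum]
  exact sum_congr rfl fun b _ => by rw [map_mul, Complex.conj_conj, mul_comm]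

variable [Fintype α]

/-- The purity of the left block, `Tr ρ_A(ψ)² = Σ_{a,a'} ‖ρ_A(ψ)(a,a')‖²` (the Hilbert–Schmidt norm
squared of the Hermitian `ρ_A`; `= Σ_k λ_k²` on the Schmidt spectrum, `= e^{−S₂}`).
[cite: SchuchEtAl2008, display 'S_α(ρ) = log tr ρ^α / (1 − α)' (α = 2)] -/
noncomputable def purityLeft (ψ : α × β → ℂ) : ℝ := ∑ a, ∑ a', ‖reducedLeft ψ a a'‖ ^ 2

/-- `Tr ρ_A² ≥ 0`. [folklore] -/
private theorem purityLeft_nonneg (ψ : α × β → ℂ) : 0 ≤ purityLeft ψ :=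
  sum_nonneg fun _ _ => sum_nonneg fun _ _ => sq_nonneg _

/-- **The block weight of a left vector is the quadratic form of `ρ_A`**: for any `x : α → ℂ`,
`Σ_b ‖(⟨x|⊗1)ψ (b)‖² = Σ_{a,a'} conj(x a) · ρ_A(a,a') · x a'` (as complex numbers; the right side is
therefore real and non-negative). [folklore] -/
private theorem sum_norm_sq_contractLeft_eq (x : α → ℂ) (ψ : α × β → ℂ) :
    ((∑ b, ‖contractLeft x ψ b‖ ^ 2 : ℝ) : ℂ) = ∑ a, ∑ a', conj (x a) * reducedLeft ψ a a' * x a' := by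
  push_cast
  calc ∑ b, ((‖contractLeft x ψ b‖ : ℝ) : ℂ) ^ 2
      = ∑ b, contractLeft x ψ b * conj (contractLeft x ψ b) := by
        refine sum_congr rfl fun b _ => ?_
        rw [Complex.mul_conj, Complex.normSq_eq_norm_sq]; push_cast; ring
    _ = ∑ b, ∑ a, ∑ a', conj (x a) * ψ (a, b) * (x a' * conj (ψ (a', b))) := by
        refine sum_congr rfl fun b _ => ?_
        unfold contractLeft
        rw [map_sum, sum_mul]
        refine sum_congr rfl fun a _ => ?_
        rw [mul_sum]
        refine sum_congr rfl fun a' _ => ?_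
        rw [map_mul, Complex.conj_conj]
    _ = ∑ a, ∑ b, ∑ a', conj (x a) * ψ (a, b) * (x a' * conj (ψ (a', b))) := sum_comm
    _ = ∑ a, ∑ a', ∑ b, conj (x a) * ψ (a, b) * (x a' * conj (ψ (a', b))) :=
        sum_congr rfl fun a _ => sum_comm
    _ = ∑ a, ∑ a', conj (x a) * reducedLeft ψ a a' * x a' := by
        refine sum_congr rfl fun a _ => sum_congr rfl fun a' _ => ?_
        unfold reducedLeft
        rw [mul_sum, sum_mul]
        exact sum_congr rfl fun b _ => by ring

end Reduced

/-! ### The rank–purity bound -/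

section Bound

variable {α β κ' : Type*} [Fintype α] [Fintype β] [DecidableEq κ']

omit [DecidableEq κ'] in
/-- `⟨ψ | Σ_{j∈J} x_j ⊗ y_j⟩ = Σ_{j∈J} ⟨(⟨x_j|⊗1)ψ | y_j⟩` (as in `SchmidtRankApproximation`). [folklore] -/
private theorem braket_productSum_eq_sum (ψ : α × β → ℂ) (x : κ' → α → ℂ) (y : κ' → β → ℂ) (J : Finset κ') :
    braket ψ (productSum x y J) = ∑ j ∈ J, braket (contractLeft (x j) ψ) (y j) := by
  unfold braket productSum contractLeft
  simp_rw [mul_sum, map_sum, map_mul, Complex.conj_conj, sum_mul]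
  rw [sum_comm]
  refine sum_congr rfl fun j _ => ?_
  rw [Fintype.sum_prod_type, sum_comm]
  exact sum_congr rfl fun b _ => sum_congr rfl fun a _ => by dsimp only; ring

/-- A member of an orthonormal family is a unit vector. [folklore] -/
private theorem sum_norm_sq_of_isOrthonormalFamily {x : κ' → α → ℂ} (hx : IsOrthonormalFamily x) (j : κ') :
    ∑ a, ‖x j a‖ ^ 2 = 1 := by
  rw [sum_norm_sq_eq_braket_re, hx j j, if_pos rfl, Complex.one_re]

/-- **Fidelity of a Schmidt-rank-`#J` competitor is at most `√(#J · Tr ρ_A²)` — SVD-free purity form.**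
For ANY amplitude table `ψ : α × β → ℂ` (no normalisation, no Schmidt form needed) and any unit vector
`φ = Σ_{j∈J} x_j ⊗ y_j` with `x` orthonormal (right factors arbitrary):
`|⟨ψ|φ⟩|² ≤ √(#J · Tr ρ_A(ψ)²)`. The `α = 2` case of [cite: SchuchEtAl2008, α > 1 displays after eq. (5)]
combined with [cite: VidalJonathanNielsen2000, §IV.B (`F_opt = Σ_{i≤m} β_i`)]; re-derived as
[cite: MorvanEtAl2024, Supplementary Information §H.2 eq. (H14)]. Proof WITHOUT the spectral theorem:
Cauchy–Schwarz twice, Cauchy–Schwarz with the all-ones vector, and Bessel (`sum_norm_sq_braket_le`). -/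
theorem overlapSq_productSum_le_sqrt_card_mul_purityLeft {x : κ' → α → ℂ} (hx : IsOrthonormalFamily x)
    (y : κ' → β → ℂ) (J : Finset κ') (ψ : α × β → ℂ) (hφ : ∑ i, ‖productSum x y J i‖ ^ 2 = 1) :
    overlapSq ψ (productSum x y J) ≤ Real.sqrt (J.card * purityLeft ψ) := by
  classical
  -- block vectors ψ_j = (⟨x_j|⊗1)ψ and their weights r_j = ‖ψ_j‖²
  set ψ' : κ' → β → ℂ := fun j => contractLeft (x j) ψ with hψ'
  set r : κ' → ℝ := fun j => ∑ b, ‖ψ' j b‖ ^ 2 with hr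
  have hr0 : ∀ j, 0 ≤ r j := fun j => sum_nonneg fun b _ => sq_nonneg _
  -- (1) ‖φ‖² = Σ_{j∈J} Σ_b ‖y_j b‖² = 1
  have hy : ∑ j ∈ J, ∑ b, ‖y j b‖ ^ 2 = 1 := by rw [← sum_norm_sq_productSum hx y J]; exact hφ
  -- (2) F ≤ Σ_{j∈J} r_j : Cauchy–Schwarz over the pairs (j, b) ∈ J × β
  have hF : overlapSq ψ (productSum x y J) ≤ ∑ j ∈ J, r j := by
    rw [overlapSq_eq_norm_braket_sq, braket_productSum_eq_sum]
    have e1 : ∑ j ∈ J, braket (ψ' j) (y j) = ∑ p ∈ J ×ˢ (univ : Finset β), conj (ψ' p.1 p.2) * y p.1 p.2 := by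
      rw [sum_product]; rfl
    rw [e1]
    refine (norm_sum_conj_mul_sq_le _ _ _).trans ?_
    rw [sum_product, sum_product, hy, mul_one]
  -- (3) Σ_{j∈J} r_j ≤ √(#J · Σ_{j∈J} r_j²) : Cauchy–Schwarz with the all-ones vector
  have h3 : ∑ j ∈ J, r j ≤ Real.sqrt (J.card * ∑ j ∈ J, r j ^ 2) := by
    have hcs := sum_mul_sq_le_sq_mul_sq J (fun _ => (1 : ℝ)) r
    simp only [one_mul, one_pow, sum_const, nsmul_eq_mul, mul_one] at hcs
    exact (le_abs_self _).trans (Real.abs_le_sqrt hcs)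
  -- (4) r_j = ⟨x_j|ρ_A|x_j⟩ and r_j² ≤ Σ_a ‖(ρ_A x_j)(a)‖² (Cauchy–Schwarz, ‖x_j‖ = 1)
  set ρx : κ' → α → ℂ := fun j a => ∑ a', reducedLeft ψ a a' * x j a' with hρx
  have hr_id : ∀ j, ((r j : ℝ) : ℂ) = ∑ a, conj (x j a) * ρx j a := by
    intro j
    rw [hr]; dsimp only
    rw [hψ', sum_norm_sq_contractLeft_eq]
    exact sum_congr rfl fun a _ => by
      rw [hρx]; dsimp only; rw [mul_sum]; exact sum_congr rfl fun a' _ => by ring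
  have hr_sq : ∀ j, r j ^ 2 ≤ ∑ a, ‖ρx j a‖ ^ 2 := by
    intro j
    have hcs := norm_sum_conj_mul_sq_le univ (x j) (ρx j)
    rw [← hr_id j, Complex.norm_real, Real.norm_of_nonneg (hr0 j), sum_norm_sq_of_isOrthonormalFamily hx j,
      one_mul] at hcs
    exact hcs
  -- (5) Σ_{j∈J} Σ_a ‖(ρ_A x_j)(a)‖² ≤ Tr ρ_A² : Bessel for the orthonormal x_j against each row of ρ_A
  have hbessel : ∑ j ∈ J, ∑ a, ‖ρx j a‖ ^ 2 ≤ purityLeft ψ := by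
    rw [sum_comm]
    refine sum_le_sum fun a _ => ?_
    have h := sum_norm_sq_braket_le hx J (fun a' => conj (reducedLeft ψ a a'))
    simp only [Complex.norm_conj] at h
    refine le_trans (le_of_eq (sum_congr rfl fun j _ => ?_)) h
    rw [hρx]; dsimp only
    unfold braket
    congr 1
    rw [← Complex.norm_conj, map_sum]
    exact congrArg _ (sum_congr rfl fun a' _ => by rw [map_mul, mul_comm])
  -- (6) assemble
  have hJ0 : (0 : ℝ) ≤ J.card := Nat.cast_nonneg _
  calc overlapSq ψ (productSum x y J) ≤ ∑ j ∈ J, r j := hF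
    _ ≤ Real.sqrt (J.card * ∑ j ∈ J, r j ^ 2) := h3
    _ ≤ Real.sqrt (J.card * purityLeft ψ) := by
        apply Real.sqrt_le_sqrt
        exact mul_le_mul_of_nonneg_left ((sum_le_sum fun j _ => hr_sq j).trans hbessel) hJ0

/-- The bound with a rank CAP `#J ≤ D` in place of `#J`. [cite: SchuchEtAl2008, after eq. (5) (α = 2)] -/
theorem overlapSq_productSum_le_sqrt_mul_purityLeft {x : κ' → α → ℂ} (hx : IsOrthonormalFamily x)
    (y : κ' → β → ℂ) {J : Finset κ'} {D : ℕ} (hJ : J.card ≤ D) (ψ : α × β → ℂ)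
    (hφ : ∑ i, ‖productSum x y J i‖ ^ 2 = 1) :
    overlapSq ψ (productSum x y J) ≤ Real.sqrt (D * purityLeft ψ) :=
  (overlapSq_productSum_le_sqrt_card_mul_purityLeft hx y J ψ hφ).trans
    (Real.sqrt_le_sqrt (mul_le_mul_of_nonneg_right (by exact_mod_cast hJ) (purityLeft_nonneg ψ)))

/-- **Finite-ensemble MEAN form.** For states `ψ_i` and unit competitors `φ_i = Σ_{j∈J_i} x_{ij} ⊗ y_{ij}`
of Schmidt rank `≤ D` (`x_i` orthonormal), indexed by a nonempty finite type `ι` (e.g. a circuit ensemble,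
one competitor per circuit, each reshaped along its own cut):
`(1/|ι|) Σ_i |⟨ψ_i|φ_i⟩|² ≤ √(D · (1/|ι|) Σ_i Tr ρ_A(ψ_i)²)` — the pointwise bound and concavity of `√`
(Cauchy–Schwarz with the all-ones vector): the circuit-AVERAGED use of the bound in
[cite: DecrossEtAl2024, App. A eq. (A36) (`χ ≥ F̄ / ⟨Tr ρ²⟩`, averaged over circuits)], here as an inequality
(with the square root of the certified pointwise form). -/
theorem sum_overlapSq_productSum_le_sqrt {ι : Type*} [Fintype ι] [Nonempty ι] (D : ℕ)
    (ψ : ι → α × β → ℂ) (x : ι → κ' → α → ℂ) (y : ι → κ' → β → ℂ) (J : ι → Finset κ')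
    (hx : ∀ i, IsOrthonormalFamily (x i)) (hJ : ∀ i, (J i).card ≤ D)
    (hφ : ∀ i, ∑ p, ‖productSum (x i) (y i) (J i) p‖ ^ 2 = 1) :
    (∑ i, overlapSq (ψ i) (productSum (x i) (y i) (J i))) / Fintype.card ι
      ≤ Real.sqrt (D * ((∑ i, purityLeft (ψ i)) / Fintype.card ι)) := by
  set F : ι → ℝ := fun i => overlapSq (ψ i) (productSum (x i) (y i) (J i)) with hFdef
  have hN : (0 : ℝ) < Fintype.card ι := by exact_mod_cast Fintype.card_pos
  have hD0 : (0 : ℝ) ≤ D := Nat.cast_nonneg _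
  have hpt : ∀ i, F i ≤ Real.sqrt (D * purityLeft (ψ i)) :=
    fun i => overlapSq_productSum_le_sqrt_mul_purityLeft (hx i) (y i) (hJ i) (ψ i) (hφ i)
  have hS0 : 0 ≤ ∑ i, F i := sum_nonneg fun i _ => overlapSq_nonneg _ _
  have hS : ∑ i, F i ≤ ∑ i, Real.sqrt (D * purityLeft (ψ i)) := sum_le_sum fun i _ => hpt i
  have hcs := sum_mul_sq_le_sq_mul_sq univ (fun _ : ι => (1 : ℝ)) (fun i => Real.sqrt (D * purityLeft (ψ i)))
  simp only [one_mul, one_pow, sum_const, card_univ, nsmul_eq_mul, mul_one] at hcs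
  have hg2 : ∑ i, Real.sqrt (D * purityLeft (ψ i)) ^ 2 = D * ∑ i, purityLeft (ψ i) := by
    rw [mul_sum]; exact sum_congr rfl fun i _ => Real.sq_sqrt (mul_nonneg hD0 (purityLeft_nonneg _))
  rw [hg2] at hcs
  have hL0 : 0 ≤ (∑ i, F i) / Fintype.card ι := div_nonneg hS0 hN.le
  have hsq : ((∑ i, F i) / Fintype.card ι) ^ 2 ≤ D * ((∑ i, purityLeft (ψ i)) / Fintype.card ι) := by
    rw [div_pow]
    calc (∑ i, F i) ^ 2 / (Fintype.card ι : ℝ) ^ 2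
        ≤ (∑ i, Real.sqrt (D * purityLeft (ψ i))) ^ 2 / (Fintype.card ι : ℝ) ^ 2 :=
          div_le_div_of_nonneg_right (pow_le_pow_left₀ hS0 hS 2) (sq_nonneg _)
      _ ≤ ((Fintype.card ι : ℝ) * (D * ∑ i, purityLeft (ψ i))) / (Fintype.card ι : ℝ) ^ 2 :=
          div_le_div_of_nonneg_right hcs (sq_nonneg _)
      _ = D * ((∑ i, purityLeft (ψ i)) / Fintype.card ι) := by field_simp
  have h := Real.abs_le_sqrt hsq
  rwa [abs_of_nonneg hL0] at h

end Bound

/-! ### Read on a left-canonical matrix product state -/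

section MPSForm

variable {σ χ : Type*} [Fintype σ] [Fintype χ] [DecidableEq χ] {k m : ℕ}

/-- **A left-canonical MPS of bond index type `χ` has fidelity at most `√(#χ · Tr ρ_A(ψ)²)` with any
target amplitude table `ψ`, at every cut `k | m`** (left blocks orthonormal: `leftGram = 1`; unit MPS).
The `α = 2` bond-dimension bound of
[cite: SchuchEtAl2008, after eq. (5) (`log D ≥ S_α + (α/(α−1)) log Σ_{i≤D} λ_i`, α = 2)] on the
left-normalised cut decomposition of [cite: Schollwoeck2011AnnPhys, §4.1.3 (i)
(`|ψ⟩ = Σ_{a_ℓ} |a_ℓ⟩_A |a_ℓ⟩_B`, '`{|a_ℓ⟩_A}` form an orthonormal set')]. -/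
theorem MPS.overlapSq_cutVec_le_sqrt_card_mul_purityLeft (A : Fin (k + m) → σ → Matrix χ χ ℂ)
    (l r : χ → ℂ) (hG : MPS.leftGram (MPS.headSites A) l = 1)
    (hunit : ∑ st, ‖MPS.cutVec A l r st‖ ^ 2 = 1) (ψ : (Fin k → σ) × (Fin m → σ) → ℂ) :
    overlapSq ψ (MPS.cutVec A l r) ≤ Real.sqrt (Fintype.card χ * purityLeft ψ) := by
  rw [MPS.cutVec_eq_productSum] at hunit ⊢
  rw [← Finset.card_univ]
  exact overlapSq_productSum_le_sqrt_card_mul_purityLeft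
    ((MPS.isOrthonormalFamily_leftBlock_iff _ _).mpr hG) _ _ ψ hunit

end MPSForm

/-! ### The linear (flat-spectrum) form is not an inequality -/

/-- **The linear form `|⟨ψ|φ⟩|² ≤ #J · Tr ρ_A²` is FALSE** (the flat-spectrum estimate `χ ≥ F/Tr ρ²` of
DecrossEtAl2024 App. A (A36) read as an inequality): on `Fin 2 × Fin 2`, `ψ = diag(4/5, 3/5)` (unit,
Schmidt weights `16/25, 9/25`), the rank-one unit competitor `φ = e₀ ⊗ e₀` has `|⟨ψ|φ⟩|² = 16/25 >
337/625 = Tr ρ_A(ψ)²`. The certified form is the square-root one above; the source itself warns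
[cite: DecrossEtAl2024, App. A, sentence after eq. (A36) ('the bound is only tight for states with a flat
Schmidt spectrum')]. -/
theorem not_overlapSq_le_card_mul_purityLeft :
    ¬ (∀ (x : Fin 1 → Fin 2 → ℂ) (y : Fin 1 → Fin 2 → ℂ) (J : Finset (Fin 1)) (ψ : Fin 2 × Fin 2 → ℂ),
        IsOrthonormalFamily x → ∑ i, ‖productSum x y J i‖ ^ 2 = 1 → ∑ i, ‖ψ i‖ ^ 2 = 1 →
          overlapSq ψ (productSum x y J) ≤ J.card * purityLeft ψ) := by
  intro h
  -- the witness
  set x : Fin 1 → Fin 2 → ℂ := fun _ a => if a = 0 then 1 else 0 with hx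
  set y : Fin 1 → Fin 2 → ℂ := fun _ b => if b = 0 then 1 else 0 with hy
  set ψ : Fin 2 × Fin 2 → ℂ :=
    fun p => if p.1 = 0 ∧ p.2 = 0 then ((4 / 5 : ℝ) : ℂ) else if p.1 = 1 ∧ p.2 = 1 then ((3 / 5 : ℝ) : ℂ) else 0
    with hψ
  have hxo : IsOrthonormalFamily x := by
    intro i j
    fin_cases i; fin_cases j
    simp [braket, x]
  have hφ1 : ∑ i, ‖productSum x y univ i‖ ^ 2 = 1 := by
    simp [productSum, x, y, Fintype.sum_prod_type, Fin.sum_univ_two]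
  have hψ1 : ∑ i, ‖ψ i‖ ^ 2 = 1 := by
    simp [ψ, Fintype.sum_prod_type, Fin.sum_univ_two]; norm_num
  have hF : overlapSq ψ (productSum x y univ) = 16 / 25 := by
    simp [overlapSq, productSum, x, y, ψ, Fintype.sum_prod_type]; norm_num
  have hP : purityLeft ψ = 337 / 625 := by
    simp [purityLeft, reducedLeft, ψ, Fin.sum_univ_two]; norm_num
  have h1 := h x y univ ψ hxo hφ1 hψ1
  rw [hF, hP] at h1
  simp at h1
  norm_num at h1

end Literature.Computability.QuantumComplexity
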